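import Mathlib
import Summits.Ventures.PercRepro.TriangleCapSubBandInterval

/-!
# PercRepro — THE WITNESSES LIE IN THEIR SUB-BAND: THE SUB-BAND `u` AS A SET OF GRAPHS (p3, gen 52; part 267)

The off-degree of the vertex `1` in a pair witness is the number of pairs with left end `1`
(`offDeg_genWitness_one`); for the interior witness of part 263 that is `t − u`, and `1` is a non-neighbour of `0`
(`interiorWitness_member`).  So the sub-band `u` — THE SET of band values `j` of graphs with a non-neighbour of
off-degree `t − u` — is EXACTLY the interval `[u (t − u − 1), u (t − u − 1) + W(u, ℓ)]` (`subband_set_exact`,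
`2 ≤ ℓ ≤ u + 1`, `2 u ≤ t`, `2 t ≤ s`), with no qualification left in words.  Axioms: standard.
-/

namespace PercRepro

namespace TriangleCap

namespace C047

open Finset

/-- The off-degree of the vertex `1` in a pair witness: the pairs with left end `1`. -/
theorem offDeg_genWitness_one (n a r t : ℕ) (hn : 0 < n) (lf rf : ℕ → ℕ) (hg : GoodEnds n a t lf rf) (ha : 2 ≤ a)
    (han : a ≤ n) :
    offDeg (missingGraph (genWitness n a r t hn lf rf) (leftPart n a)) (fin' n hn 0) (fin' n hn 1) =
      ((range t).filter (fun i => lf i = 1)).card := by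
  unfold offDeg
  rw [offEdges_missingGraph_genWitness n a r t hn lf rf hg han]
  unfold genPairs
  rw [card_filter_image_of_injOn (fun i hi i' hi' h => by
    rw [mem_coe, mem_range] at hi hi'
    exact (genPair_eq_iff n a t hn lf rf hg i i' hi hi' han).mp h)]
  apply congrArg
  apply filter_congr
  intro i hi
  rw [mem_range] at hi
  rw [mem_genPair_iff n a t hn lf rf hg i hi han, fin'_val n hn 1 (by omega)]
  have := hg.2.1 i hi
  constructor
  · rintro (h | h)
    · exact h.symm
    · omega
  · intro h
    exact Or.inl h.symm

/-- The vertex `1` is a non-neighbour of `0` in a pair witness (`2 ≤ a`). -/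
theorem not_adj_genWitness_one (n a r t : ℕ) (hn : 0 < n) (lf rf : ℕ → ℕ) (ha : 2 ≤ a) (han : a ≤ n) :
    ¬ (missingGraph (genWitness n a r t hn lf rf) (leftPart n a)).Adj (fin' n hn 0) (fin' n hn 1) := by
  intro h
  have h0 : (fin' n hn 0).val < a := by rw [fin'_val n hn 0 (by omega)]; omega
  have h1 : (fin' n hn 1).val < a := by rw [fin'_val n hn 1 (by omega)]; omega
  have hb := bipSub_missingGraph (genWitness n a r t hn lf rf) (leftPart n a) _ _ h
  unfold leftPart at hb
  simp only [mem_filter, mem_univ, true_and] at hb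
  exact (hb.mp h0) h1

/-- **THE INTERIOR WITNESS LIES IN THE SUB-BAND `u`:** it has a non-neighbour (`1`) of off-degree `t − u`. -/
theorem interiorWitness_member (ℓ s t u k v e c : ℕ) (hk : 1 ≤ k) (he : e + k + 1 ≤ ℓ) (hu : 1 ≤ u)
    (hut : 2 * u ≤ t) (hc : c ≤ u) (hce : c + e ≤ t - u) (hs : 2 * t ≤ s) :
    ∃ (H : SimpleGraph (Fin (ℓ + 1 + (s - t)))) (_ : DecidableRel H.Adj), H.CliqueFree 3 ∧
      H.edgeFinset.card = s ∧ (∃ w, deg H w + t = s ∧ ∃ x, offDeg H w x + u = t ∧ ¬ H.Adj w x) ∧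
      ∑ v', deg H v' * deg H v' + 2 * (t * (s - t - 1)) +
        (2 * e + 2 * (u * (t - u - 1)) + u * (u + 1) - coll u (lfRR k v) - 2 * c) = s * (s + 1) := by
  set n := ℓ + 1 + (s - t) with hn
  have hn0 : 0 < n := by omega
  have hg : GoodEnds n (k + 2) t (lfInt t u k v) (rfInt s t u k e c) := by
    refine ⟨fun i hi => ?_, fun i hi => ?_, fun i i' hi hi' h1 h2 => ?_⟩
    · unfold lfInt
      have := lfRR_bounds k v (i - (t - u)) hk
      split_ifs <;> omega
    · rcases rfInt_cases s t u k e c i hi with ⟨hi1, hv⟩ | ⟨hi1, hi2, hv⟩ | ⟨hi1, hi2, hv⟩ |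
          ⟨hi1, hi2, hv⟩ <;> rw [hv] <;> omega
    · have hb1 := lfRR_bounds k v (i - (t - u)) hk
      have hb2 := lfRR_bounds k v (i' - (t - u)) hk
      unfold lfInt at h1
      rcases rfInt_cases s t u k e c i hi with ⟨hi1, hv⟩ | ⟨hi1, hi2, hv⟩ | ⟨hi1, hi2, hv⟩ |
          ⟨hi1, hi2, hv⟩ <;>
        rcases rfInt_cases s t u k e c i' hi' with ⟨hj1, hw⟩ | ⟨hj1, hj2, hw⟩ | ⟨hj1, hj2, hw⟩ |
          ⟨hj1, hj2, hw⟩ <;>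
        rw [hv, hw] at h2 <;> split_ifs at h1 <;> omega
  obtain ⟨H, inst, hfree, hcard, ⟨w, hw⟩, hval⟩ := interiorWitness ℓ s t u k v e c hk he hu hut hc hce hs
  -- the witness of part 263 is this very graph; we re-derive the degree and the non-adjacency at `1`
  refine ⟨missingGraph (genWitness n (k + 2) s t hn0 (lfInt t u k v) (rfInt s t u k e c)) (leftPart n (k + 2)),
    inferInstance, cliqueFree_of_bipSub _ _ (bipSub_missingGraph _ _),
    card_edges_missingGraph_genWitness n (k + 2) s t hn0 (lfInt t u k v) (rfInt s t u k e c) hg (by omega)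
      (by omega) (by omega),
    ⟨fin' n hn0 0, by
      rw [deg_missingGraph_genWitness_zero n (k + 2) s t hn0 (lfInt t u k v) (rfInt s t u k e c) hg (by omega)
        (by omega)]
      omega, fin' n hn0 1, ?_, not_adj_genWitness_one n (k + 2) s t hn0 _ _ (by omega) (by omega)⟩, ?_⟩
  · rw [offDeg_genWitness_one n (k + 2) s t hn0 (lfInt t u k v) (rfInt s t u k e c) hg (by omega) (by omega)]
    have : (range t).filter (fun i => lfInt t u k v i = 1) = range (t - u) := by
      ext i
      simp only [mem_filter, mem_range]
      unfold lfInt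
      have := lfRR_bounds k v (i - (t - u)) hk
      split_ifs <;> omega
    rw [this, card_range]
    omega
  · -- the value: the same computation as in part 263
    have hval' := genWitness_missing_value n (k + 2) s t hn0 (lfInt t u k v) (rfInt s t u k e c) hg (by omega)
      (by omega) (by omega) (by omega)
    have hatt : ((range t).filter (fun i => rfInt s t u k e c i < k + 2 + (s - t))).card = t - e := by
      have : (range t).filter (fun i => rfInt s t u k e c i < k + 2 + (s - t)) = Ico e t := by
        ext i
        simp only [mem_filter, mem_range, mem_Ico]
        constructor
        · rintro ⟨hi, hlt⟩
          rcases rfInt_cases s t u k e c i hi with ⟨hi1, hv⟩ | ⟨hi1, hi2, hv⟩ | ⟨hi1, hi2, hv⟩ |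
              ⟨hi1, hi2, hv⟩ <;> rw [hv] at hlt <;> omega
        · rintro ⟨hi1, hi2⟩
          refine ⟨hi2, ?_⟩
          rcases rfInt_cases s t u k e c i hi2 with ⟨hi1', hv⟩ | ⟨hi1', hi2', hv⟩ | ⟨hi1', hi2', hv⟩ |
              ⟨hi1', hi2', hv⟩ <;> rw [hv] <;> omega
      rw [this, Nat.card_Ico]
    rw [hatt, coll_rfInt s t u k e c hs (by omega) hc hce, coll_lfInt t u k v (by omega) hk] at hval'
    have e1 : t - (t - e) = e := by omega
    have hid := subband_identity t u (by omega)
    have hcoll := coll_le u (lfRR k v)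
    have hu1 : u * (u - 1) ≤ u * (u + 1) := Nat.mul_le_mul_left u (by omega)
    have e2 : t * (t - 1) - ((t - u) * (t - u - 1) + coll u (lfRR k v) + 2 * c) =
        2 * (u * (t - u - 1)) + u * (u + 1) - coll u (lfRR k v) - 2 * c := by omega
    rw [e1, e2] at hval'
    have e3 : 2 * e + 2 * (u * (t - u - 1)) + u * (u + 1) - coll u (lfRR k v) - 2 * c =
        2 * e + (2 * (u * (t - u - 1)) + u * (u + 1) - coll u (lfRR k v) - 2 * c) := by
      have e4 : u * (u + 1) = u * (u - 1) + 2 * u := by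
        obtain ⟨u', rfl⟩ : ∃ u', u = u' + 1 := ⟨u - 1, by omega⟩
        rw [Nat.add_sub_cancel]
        ring
      omega
    rw [e3]
    exact hval'

/-- **THE SUB-BAND `u` AS A SET, EXACTLY:** for `2 ≤ ℓ ≤ u + 1`, `2 u ≤ t`, `2 t ≤ s`, a value `j` is the band value
of a triangle-free graph on `ℓ + 1 + (s − t)` vertices with `s` edges, a vertex `w` of degree `s − t` and a
non-neighbour of `w` of off-degree `t − u` IFF `u (t − u − 1) ≤ j` and
`2 j + 2 q u ≤ 2 u (t − u − 1) + u (u + 1) + (ℓ − 1) q (q + 1)`, `q = ⌊u / (ℓ − 1)⌋`. -/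
theorem subband_set_exact (ℓ s t u j : ℕ) (hℓ : 2 ≤ ℓ) (hℓu : ℓ ≤ u + 1) (hut : 2 * u ≤ t) (hs : 2 * t ≤ s) :
    (∃ (H : SimpleGraph (Fin (ℓ + 1 + (s - t)))) (_ : DecidableRel H.Adj), H.CliqueFree 3 ∧
      H.edgeFinset.card = s ∧ (∃ w, deg H w + t = s ∧ ∃ x, offDeg H w x + u = t ∧ ¬ H.Adj w x) ∧
      ∑ v, deg H v * deg H v + 2 * (t * (s - t - 1)) + 2 * j = s * (s + 1)) ↔
    (u * (t - u - 1) ≤ j ∧ 2 * j + 2 * ((u / (ℓ - 1)) * u) ≤ 2 * (u * (t - u - 1)) + u * (u + 1) +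
      (ℓ - 1) * ((u / (ℓ - 1)) * (u / (ℓ - 1) + 1))) := by
  have hu : 1 ≤ u := by omega
  constructor
  · rintro ⟨H, _, hfree, hs', ⟨w, hw, x, hx, hxw⟩, hj'⟩
    exact (subband_interval_exact ℓ s t u hℓ hℓu hut hs).1 H hfree hs' w hw j hj' x hx hxw
  · rintro ⟨hlow, hup⟩
    -- the covering of part 263 with the member witness
    obtain ⟨m, rfl⟩ : ∃ m, j = u * (t - u - 1) + m := ⟨j - u * (t - u - 1), by omega⟩
    have hle : ∀ v, coll u (lfRR (ℓ - 1) v) ≤ u * (u - 1) := fun v => coll_le u _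
    have hu1 : u * (u - 1) + 2 * u = u * (u + 1) := by
      obtain ⟨u', rfl⟩ : ∃ u', u = u' + 1 := ⟨u - 1, by omega⟩
      rw [Nat.add_sub_cancel]
      ring
    have hth := row_threshold (ℓ - 1) u
    rw [mul_assoc] at hth
    have hc0 := coll_lfRR_zero (ℓ - 1) u (by omega)
    have hcover := cover_two_sided u 0 (fun v => u * (u + 1) - coll u (lfRR (ℓ - 1) v))
      (by show u * (u + 1) - coll u (lfRR (ℓ - 1) u) = 2 * u; rw [coll_lfRR_top]; omega)
      (fun v => by
        obtain ⟨x, hx⟩ := coll_even u (lfRR (ℓ - 1) v)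
        obtain ⟨d, hd⟩ := Nat.even_mul_succ_self u
        have := hle v
        exact ⟨d - x, by omega⟩)
      (fun v _ => by
        have h1 := coll_le_coll_add_of_eq_off u (lfRR (ℓ - 1) (v + 1)) (lfRR (ℓ - 1) v) v
          (fun i _ hi => lfRR_eq_off (ℓ - 1) v i hi)
        have := hle v
        have := hle (v + 1)
        show u * (u + 1) - coll u (lfRR (ℓ - 1) v) ≤ u * (u + 1) - coll u (lfRR (ℓ - 1) (v + 1)) + 2 * u
        omega)
      u le_rfl m (by
        show 2 * m ≤ u * (u + 1) - coll u (lfRR (ℓ - 1) (u - u)) + 2 * 0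
        rw [Nat.sub_self, hc0]
        have := hle 0
        rw [hc0] at this
        omega)
    obtain ⟨v, -, -, e, he, c, hc, hmc⟩ := hcover
    have hw := interiorWitness_member ℓ s t u (ℓ - 1) v e c (by omega) (by omega) hu hut hc (by omega) hs
    have hv := hle v
    have e5 : 2 * e + 2 * (u * (t - u - 1)) + u * (u + 1) - coll u (lfRR (ℓ - 1) v) - 2 * c =
        2 * (u * (t - u - 1) + m) := by omega
    rw [e5] at hw
    exact hw

end C047

end TriangleCap

end PercRepro
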